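import Summits.QuantumFields.BalabanUV.Beta.GAN24.HkContinuumKernel

/-!
# G-an2-4 ∕ (CONV-C), route R7 — THE NAMED `η → 0` KERNEL `Hc t` OF BAŁABAN's FINE MINIMISER `H^{(η)} = H_n` (B5 (1.63)) AT `U = 1`, EVERY TORUS:
# `‖H_n((n·ȳ′+⌊n t⌋, μ), (ȳ, λ)) − Hc t (ȳ′,μ) (ȳ,λ)‖ ≤ KHc(d)·n⁻¹·e^{−dec(d)|y′−y|_T}` FOR EVERY LEVEL `n ≥ 1` (the full `η¹` rate), `Hc t` exponentially
# localised, Lipschitz in the block offset `t`, and the common limit of every King tower `n = L^k` — PART 2 of 2 (PART 1 = `HkContinuumKernel`)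

G-an2-4 formalisation swarm `b2b-balaban-gan24-formalise-*`, leaf prover 06 (gen 38), crux team (2) under the coordinator ruling «YM REDIRECT»
(e34b3e0c; FREEZE (0) honoured; INTENT 1 «HK-CONTINUUM-KERNEL», journal `HOME/CLAIMS.log` 2026-08-21 l.31931, hold-off honoured; split in two by the
400-line rule).  NOT IN PRINT; OUR BOOKKEEPING over tree theorems BY NAME.  INPUTS: PART 1's Cauchy estimate `norm_HkOp_floor_sub_floor_le`
(⇐ `HkKingOneStep` §2 = NE2's LITERATURE strip rate `T4Hk163StripRate.torusKernel_G163_rate`, §3 = b05's `norm_dker_bpt_le`), its carrier-free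
`exists_limit_of_pairwise_rate` ∕ `le_of_forall_level`, its displacement lemma `norm_hker_bpt_sub_bpt_le`, and `HkKingOneStep.norm_HkOp_bpt_le`
(the k-uniform decay).

## What is proved (0 sorry, 0 def; `KHc(d) := CGe(d+1)·periodConst(κ₁₆₃(d+1), d) + (d+1)·KHd(d)` displayed inline, `E := e^{−dec(d)·|y′−y|_{T,∞}}`)

 * **`norm_sub_le_of_tails`**: two values obeying the full-sequence tail at the digits of two admissible offsets `t, t′ ∈ [0,1)^{d+1}` differ by
   `≤ KHd·(Σ_ν |t_ν − t′_ν|)·E` (for each `n`: two tails `2K∕n`, PART 1 §1 at level `n` with `|⌊n t_ν⌋ − ⌊n t′_ν⌋| ≤ n|t_ν − t′_ν| + 1`, then `n → ∞`).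
 * **`exists_entry_limit`** (one entry, one offset `t ∈ [0,1)^{d+1}`): `∃ s ∈ ℂ` with (tail) `‖H_n((n·ȳ′+⌊n t⌋,μ),(ȳ,λ)) − s‖ ≤ KHc·n⁻¹·E` for EVERY
   `n ≥ 1` and every admissible digit vector, (size) `‖s‖ ≤ (MG163·periodConst + KHc)·E`, (limit) `H_{k+1}((…⌊(k+1)t⌋…),…) → s` along any
   coherent digit choice — PART 1 §0 on the level family of entries with PART 1 §2's pairwise rate.
 * **`inv_cast_lev`** (`n_k⁻¹ = (L⁻¹)^k`).
 * **`exists_HkOp_continuum_kernel`** — ONE DECLARATION FOR THE CENSUS: on every torus `M` there is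
   `Hc : (Fin (d+1) → ℝ) → Matrix (Tor M × Fin (d+1)) (Tor M × Fin (d+1)) ℂ` with (A) for every `t ∈ [0,1)^{d+1}` and all `ȳ′ μ ȳ λ`:
   (i) TAIL `‖H_n((n·ȳ′+⌊n t⌋,μ),(ȳ,λ)) − Hc t (ȳ′,μ) (ȳ,λ)‖ ≤ KHc·n⁻¹·E` for every `n ≥ 1`; (ii) DECAY `‖Hc t (ȳ′,μ) (ȳ,λ)‖ ≤ (MG163·periodConst + KHc)·E`;
   (iii) LIMIT along any coherent digit choice; (iv) TOWERS: for EVERY `L ≥ 1`, `‖H_{n_k}(…⌊n_k t⌋…) − Hc t(…)‖ ≤ KHc·(L⁻¹)^k·E` at `n_k = lev L k` with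
   the SAME `Hc` (by PART 1 §4 these are King's ancestries, so `HkKingOneStep`'s towers converge to it); and (B) LIPSCHITZ: for admissible `t, t′`,
   `‖Hc t (ȳ′,μ)(ȳ,λ) − Hc t′ (ȳ′,μ)(ȳ,λ)‖ ≤ KHd·(Σ_ν|t_ν − t′_ν|)·E`.

READING.  (i) is the `|s_η − s_0| ≤ c₀·η` END-grade currency of `Beta.RateCertificate` ∕ asym1's `LimitForm.conv` for the FINE constituent `H` of the
row's triple at `U = 1`, with exponential localisation, uniformly in the torus — on Bałaban's typed object `B5Hk163Torus.HkOp`, not on a model.  The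
limit is NAMED (chosen entrywise in `ℂ`; off `[0,1)^{d+1}` unspecified), depends on `t` only through its digit sequences, and is NOT identified with any
printed continuum Green's function (R213-2 wording).  HONEST SCOPE: [folklore] corollary BY NAME; `U = 1` (abelian (1.63) ⊗ id); constants `d`-only,
crude; no `G_k(U)`, no `C^{(k)}`, no general `U`, non-abelian nothing.  NOT (CONV-C) as typed, NEVER «G-an2-4 closed», NOT NE2 ∕ NE3, NOT D1, NOT
BetaPertH, NOT continuum YM, NOT Clay; 0 def, 0 cite tag, no sorry.  Locators (text only): [Balaban1984PropagatorsI] (1.63) p. 28; [King1986] p. 664;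
[Balaban1987RG1] p. 264.  HONEST DEPENDENCY: continuum YM on T⁴ ⇐ BetaPertH ∧ nine spine estimates (0/9 proved); BetaPertH ⇐ (D1) ∧ (D4) ∧
CAP+tail; G-an2-4 gates asym, D1 and NE2/3/4.  Provenance: prover-b2b-balaban-gan24-formalise-leaf-06-g38-0 (unit `b2b-balaban-gan24-formalise-leaf-06`,
gen 38), 2026-08-21.
-/


noncomputable section

open scoped BigOperators ComplexConjugate Matrix Topology
open Finset

namespace Summit.QuantumFields.BalabanUV.Beta.GAN24.HkContinuumKernelLimit

open Filter
open Literature.MathematicalPhysics.QuantumFieldTheory.Balaban1983to89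
open Literature.MathematicalPhysics.QuantumFieldTheory.Balaban1983to89.B5Prop11Plancherel (Tor fine)
open Literature.MathematicalPhysics.QuantumFieldTheory.Balaban1983to89.B4TorusKernel (periodConst)
open Literature.MathematicalPhysics.QuantumFieldTheory.Balaban1983to89.B4TorusKernel.MultiPeriod (torusSupNorm)
open Literature.MathematicalPhysics.QuantumFieldTheory.Balaban1983to89.B5Block118 (bpt)
open Literature.MathematicalPhysics.QuantumFieldTheory.Balaban1983to89.B5Kernel166Decay (periodConst_pos)
open Literature.MathematicalPhysics.QuantumFieldTheory.Balaban1983to89.B6LowerBound2153Torus (toT rep toT_rep)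
open Literature.MathematicalPhysics.QuantumFieldTheory.Balaban1983to89.B5Hk163Strip (kappa163 kappa163_pos)
open Literature.MathematicalPhysics.QuantumFieldTheory.Balaban1983to89.B5Hk163Decay (MG163 MG163_nonneg)
open Literature.MathematicalPhysics.QuantumFieldTheory.Balaban1983to89.B5Hk163Torus (hker HkOp)
open Literature.MathematicalPhysics.QuantumFieldTheory.Balaban1983to89.T4Hk163StripRate (CGe CGe_nonneg)
open Literature.MathematicalPhysics.QuantumFieldTheory.Balaban1983to89.B5G183RateUnitTower (lev lev_neZero)
open Summit.QuantumFields.BalabanUV.T4Continuum.BalabanAveragedTowerUnit (cast_lev')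
open Summit.QuantumFields.BalabanUV.Beta.GAN24.HkKingOneStep (dec dec_pos KHd KHd_nonneg norm_HkOp_bpt_le)
open Summit.QuantumFields.BalabanUV.Beta.GAN24.HkContinuumKernel (le_of_forall_level exists_limit_of_pairwise_rate norm_hker_bpt_sub_bpt_le
  norm_HkOp_floor_sub_floor_le floor_lt_level abs_floor_sub_floor_le)

variable {d : ℕ}

/-! ## The named `η → 0` kernel at every continuum block offset, every torus -/

section Continuum

variable (M : Fin (d + 1) → ℕ) [hM : ∀ μ, NeZero (M μ)]

/-- **TWO LIMITS AT TWO OFFSETS DIFFER BY THE LIPSCHITZ BOUND**: if `s` (resp. `s′`) obeys the full-sequence tail at the digits of `t` (resp. `t′`),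
both offsets in `[0,1)^{d+1}`, then `‖s − s′‖ ≤ KHd(d)·(Σ_ν |t_ν − t′_ν|)·e^{−dec|y′−y|_T}` (for each `n`: two tails `2K∕n`, PART 1 §1 at level `n` with
`|⌊n t_ν⌋ − ⌊n t′_ν⌋| ≤ n|t_ν − t′_ν| + 1`, then `n → ∞` by `le_of_forall_level`). [folklore] -/
theorem norm_sub_le_of_tails (t t' : Fin (d + 1) → ℝ) (ht0 : ∀ ν, 0 ≤ t ν) (ht1 : ∀ ν, t ν < 1) (ht0' : ∀ ν, 0 ≤ t' ν)
    (ht1' : ∀ ν, t' ν < 1) (y' : Tor M) (μ : Fin (d + 1)) (y : Tor M) (lam : Fin (d + 1)) {K : ℝ} {s s' : ℂ}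
    (hs : ∀ (n : ℕ) [NeZero n] (a : Fin (d + 1) → Fin n), (∀ ν, (a ν : ℕ) = ⌊(n : ℝ) * t ν⌋₊) →
      ‖HkOp n M (bpt n M y' a, μ) (y, lam) - s‖ ≤ K * ((n : ℝ))⁻¹ * Real.exp (-(dec d * torusSupNorm M (rep M y' - rep M y))))
    (hs' : ∀ (n : ℕ) [NeZero n] (a : Fin (d + 1) → Fin n), (∀ ν, (a ν : ℕ) = ⌊(n : ℝ) * t' ν⌋₊) →
      ‖HkOp n M (bpt n M y' a, μ) (y, lam) - s'‖ ≤ K * ((n : ℝ))⁻¹ * Real.exp (-(dec d * torusSupNorm M (rep M y' - rep M y)))) :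
    ‖s - s'‖ ≤ KHd d * (∑ ν, |t ν - t' ν|) * Real.exp (-(dec d * torusSupNorm M (rep M y' - rep M y))) := by
  set w := Real.exp (-(dec d * torusSupNorm M (rep M y' - rep M y))) with hw
  have hw0 : 0 < w := Real.exp_pos _
  have hKHd := KHd_nonneg d
  refine le_of_forall_level (C := (2 * K + (d + 1) * KHd d) * w) fun n _ => ?_
  have hn : (0 : ℝ) < n := by exact_mod_cast Nat.pos_of_ne_zero (NeZero.ne n)
  -- the digits of `t` and `t′` at level `n`
  set a : Fin (d + 1) → Fin n := fun ν => ⟨⌊(n : ℝ) * t ν⌋₊, floor_lt_level n (ht0 ν) (ht1 ν)⟩ with ha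
  set a' : Fin (d + 1) → Fin n := fun ν => ⟨⌊(n : ℝ) * t' ν⌋₊, floor_lt_level n (ht0' ν) (ht1' ν)⟩ with ha'
  have h1 := hs n a (fun ν => rfl)
  have h2 := hs' n a' (fun ν => rfl)
  have h3 : ‖HkOp n M (bpt n M y' a, μ) (y, lam) - HkOp n M (bpt n M y' a', μ) (y, lam)‖
      ≤ (∑ ν, |((a ν : ℕ) : ℝ) - ((a' ν : ℕ) : ℝ)|) * ((n : ℝ)⁻¹ * (KHd d * w)) := by
    have h := norm_hker_bpt_sub_bpt_le n M μ lam (rep M y') (rep M y) a a'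
    rwa [toT_rep, toT_rep] at h
  have hdig : (∑ ν, |((a ν : ℕ) : ℝ) - ((a' ν : ℕ) : ℝ)|) ≤ (n : ℝ) * (∑ ν, |t ν - t' ν|) + (d + 1) := by
    calc (∑ ν, |((a ν : ℕ) : ℝ) - ((a' ν : ℕ) : ℝ)|) ≤ ∑ ν, ((n : ℝ) * |t ν - t' ν| + 1) := by
          refine Finset.sum_le_sum fun ν _ => ?_
          have h := abs_floor_sub_floor_le (x := (n : ℝ) * t ν) (y := (n : ℝ) * t' ν)
            (mul_nonneg hn.le (ht0 ν)) (mul_nonneg hn.le (ht0' ν))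
          rw [← mul_sub, abs_mul, abs_of_pos hn] at h
          exact h
      _ = (n : ℝ) * (∑ ν, |t ν - t' ν|) + (d + 1) := by
          rw [Finset.sum_add_distrib, ← Finset.mul_sum, Finset.sum_const, Finset.card_univ, Fintype.card_fin]
          simp
  have h3' : ‖HkOp n M (bpt n M y' a, μ) (y, lam) - HkOp n M (bpt n M y' a', μ) (y, lam)‖
      ≤ ((n : ℝ) * (∑ ν, |t ν - t' ν|) + (d + 1)) * ((n : ℝ)⁻¹ * (KHd d * w)) :=
    h3.trans (mul_le_mul_of_nonneg_right hdig (by positivity))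
  set U := HkOp n M (bpt n M y' a, μ) (y, lam) with hU
  set U' := HkOp n M (bpt n M y' a', μ) (y, lam) with hU'
  have htri : ‖s - s'‖ ≤ ‖U - s‖ + ‖U - U'‖ + ‖U' - s'‖ :=
    calc ‖s - s'‖ = ‖(U' - s') + (U - U') - (U - s)‖ := by congr 1; abel
      _ ≤ ‖(U' - s') + (U - U')‖ + ‖U - s‖ := norm_sub_le _ _
      _ ≤ ‖U' - s'‖ + ‖U - U'‖ + ‖U - s‖ := add_le_add (norm_add_le _ _) le_rfl
      _ = ‖U - s‖ + ‖U - U'‖ + ‖U' - s'‖ := by ring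
  refine htri.trans ((add_le_add (add_le_add h1 h3') h2).trans (le_of_eq ?_))
  field_simp
  ring

/-- **THE LIMIT OF ONE ENTRY AT ONE CONTINUUM OFFSET**: for `t ∈ [0,1)^{d+1}`, unit points `ȳ′, ȳ`, components `μ, λ`, there is `s ∈ ℂ` with
(tail) `‖H_n((n·ȳ′+⌊n t⌋, μ), (ȳ, λ)) − s‖ ≤ (CGe·periodConst + (d+1)·KHd)·n⁻¹·e^{−dec|y′−y|_T}` for EVERY level `n ≥ 1` and every admissible digit
vector; (size) `‖s‖ ≤ (MG163·periodConst + CGe·periodConst + (d+1)·KHd)·e^{−dec|y′−y|_T}`; (limit) along any coherent digit choice `A k = ⌊(k+1) t⌋`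
the entries `H_{k+1}((…A k…),…)` tend to `s`.  PART 1 §0 on the family `n ↦ H_n((n·ȳ′+⌊n t⌋,μ),(ȳ,λ))` with PART 1 §2's pairwise rate. [folklore] -/
theorem exists_entry_limit (t : Fin (d + 1) → ℝ) (ht0 : ∀ ν, 0 ≤ t ν) (ht1 : ∀ ν, t ν < 1)
    (y' : Tor M) (μ : Fin (d + 1)) (y : Tor M) (lam : Fin (d + 1)) :
    ∃ s : ℂ,
      (∀ (n : ℕ) [NeZero n] (a : Fin (d + 1) → Fin n), (∀ ν, (a ν : ℕ) = ⌊(n : ℝ) * t ν⌋₊) →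
          ‖HkOp n M (bpt n M y' a, μ) (y, lam) - s‖
            ≤ (CGe (d + 1) * periodConst (kappa163 (d + 1)) d + (d + 1) * KHd d) * ((n : ℝ))⁻¹
                * Real.exp (-(dec d * torusSupNorm M (rep M y' - rep M y)))) ∧
      ‖s‖ ≤ (MG163 (d + 1) * periodConst (kappa163 (d + 1)) d
              + (CGe (d + 1) * periodConst (kappa163 (d + 1)) d + (d + 1) * KHd d))
            * Real.exp (-(dec d * torusSupNorm M (rep M y' - rep M y))) ∧
      (∀ A : (k : ℕ) → (Fin (d + 1) → Fin (k + 1)), (∀ k ν, (A k ν : ℕ) = ⌊((k : ℝ) + 1) * t ν⌋₊) →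
          Tendsto (fun k : ℕ => HkOp (k + 1) M (bpt (k + 1) M y' (A k), μ) (y, lam)) atTop (𝓝 s)) := by
  -- the canonical digit family and the level family of entries
  let dg : (n : ℕ) → [NeZero n] → (Fin (d + 1) → Fin n) :=
    fun n _ ν => ⟨⌊(n : ℝ) * t ν⌋₊, floor_lt_level n (ht0 ν) (ht1 ν)⟩
  let u : (n : ℕ) → [NeZero n] → ℂ := fun n _ => HkOp n M (bpt n M y' (dg n), μ) (y, lam)
  set w := Real.exp (-(dec d * torusSupNorm M (rep M y' - rep M y))) with hw
  set K := CGe (d + 1) * periodConst (kappa163 (d + 1)) d + (d + 1) * KHd d with hK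
  have hpair : ∀ (n m : ℕ) [NeZero n] [NeZero m], ‖u m - u n‖ ≤ K * (((n : ℝ))⁻¹ + ((m : ℝ))⁻¹) * w := by
    intro n m _ _
    have h := norm_HkOp_floor_sub_floor_le (n := n) (m := m) M μ lam (rep M y') (rep M y) t ht0 (dg n) (dg m)
      (fun ν => rfl) (fun ν => rfl)
    rwa [toT_rep, toT_rep] at h
  obtain ⟨s, hlim, htail, hs⟩ := exists_limit_of_pairwise_rate u hpair
  -- any admissible digit vector IS the canonical one
  have hdg : ∀ (n : ℕ) [NeZero n] (a : Fin (d + 1) → Fin n), (∀ ν, (a ν : ℕ) = ⌊(n : ℝ) * t ν⌋₊) → a = dg n := by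
    intro n _ a ha; funext ν; exact Fin.ext (ha ν)
  refine ⟨s, fun n _ a ha => ?_, ?_, fun A hA => ?_⟩
  · rw [hdg n a ha]; exact htail n
  · have h1 : ‖u 1‖ ≤ MG163 (d + 1) * periodConst (kappa163 (d + 1)) d * w := by
      have := norm_HkOp_bpt_le 1 M μ lam (dg 1) (rep M y') (rep M y)
      rwa [toT_rep, toT_rep] at this
    calc ‖s‖ ≤ ‖u 1‖ + K * w := hs
      _ ≤ MG163 (d + 1) * periodConst (kappa163 (d + 1)) d * w + K * w := add_le_add h1 le_rfl
      _ = _ := by rw [hK]; ring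
  · have hfun : (fun k : ℕ => HkOp (k + 1) M (bpt (k + 1) M y' (A k), μ) (y, lam)) = fun k : ℕ => u (k + 1) := by
      funext k
      have hAk : A k = dg (k + 1) := hdg (k + 1) (A k) (fun ν => by rw [hA k ν]; push_cast; rfl)
      rw [hAk]
    rw [hfun]; exact hlim

omit hM in
/-- `n_k⁻¹ = (L⁻¹)^k` for the level sequence `n_k = L^k`. [folklore] -/
theorem inv_cast_lev (L : ℕ) [NeZero L] (k : ℕ) : (((lev L k : ℕ) : ℝ))⁻¹ = ((L : ℝ)⁻¹) ^ k := by
  rw [cast_lev', inv_pow]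

/-- **THE NAMED `η → 0` KERNEL OF BAŁABAN's FINE MINIMISER AT `U = 1`, EVERY TORUS** — one declaration for the census.  On the torus `M` there is
`Hc : (Fin (d+1) → ℝ) → Matrix (Tor M × Fin (d+1)) (Tor M × Fin (d+1)) ℂ` such that, writing `KHc := CGe(d+1)·periodConst + (d+1)·KHd(d)` and
`E := e^{−dec(d)·|y′−y|_{T,∞}}`:
(A) for every offset `t ∈ [0,1)^{d+1}` and all `ȳ′ μ ȳ λ`:
  (i) TAIL, every level `n ≥ 1`, every admissible digit vector `a = ⌊n t⌋`: `‖H_n((n·ȳ′+a,μ),(ȳ,λ)) − Hc t (ȳ′,μ) (ȳ,λ)‖ ≤ KHc·n⁻¹·E` (the full `η¹` rate);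
  (ii) DECAY: `‖Hc t (ȳ′,μ) (ȳ,λ)‖ ≤ (MG163·periodConst + KHc)·E`;
  (iii) LIMIT: along any coherent digit choice `A k = ⌊(k+1)t⌋`, `H_{k+1}((…A k…,μ),(ȳ,λ)) → Hc t (ȳ′,μ) (ȳ,λ)`;
  (iv) TOWERS: for EVERY `L ≥ 1` and every `k`, at `n_k = lev L k = L^k`: `‖H_{n_k}((n_k·ȳ′+⌊n_k t⌋,μ),(ȳ,λ)) − Hc t (ȳ′,μ) (ȳ,λ)‖ ≤ KHc·(L⁻¹)^k·E`
       — the SAME `Hc` for every `L` (by PART 1 §4 these points are King's ancestry, so `HkKingOneStep`'s towers converge to it);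
(B) LIPSCHITZ in the offset: for `t, t′ ∈ [0,1)^{d+1}` and all entries, `‖Hc t (ȳ′,μ)(ȳ,λ) − Hc t′ (ȳ′,μ)(ȳ,λ)‖ ≤ KHd·(Σ_ν|t_ν − t′_ν|)·E`.
`Hc t` is chosen entrywise (`exists_entry_limit`); off `[0,1)^{d+1}` it is unspecified.  NOT identified with any printed continuum kernel.
[folklore] -/
theorem exists_HkOp_continuum_kernel :
    ∃ Hc : (Fin (d + 1) → ℝ) → Matrix (Tor M × Fin (d + 1)) (Tor M × Fin (d + 1)) ℂ,
      (∀ (t : Fin (d + 1) → ℝ), (∀ ν, 0 ≤ t ν) → (∀ ν, t ν < 1) →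
        ∀ (y' : Tor M) (μ : Fin (d + 1)) (y : Tor M) (lam : Fin (d + 1)),
          (∀ (n : ℕ) [NeZero n] (a : Fin (d + 1) → Fin n), (∀ ν, (a ν : ℕ) = ⌊(n : ℝ) * t ν⌋₊) →
              ‖HkOp n M (bpt n M y' a, μ) (y, lam) - Hc t (y', μ) (y, lam)‖
                ≤ (CGe (d + 1) * periodConst (kappa163 (d + 1)) d + (d + 1) * KHd d) * ((n : ℝ))⁻¹
                    * Real.exp (-(dec d * torusSupNorm M (rep M y' - rep M y)))) ∧
          ‖Hc t (y', μ) (y, lam)‖ ≤ (MG163 (d + 1) * periodConst (kappa163 (d + 1)) d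
                + (CGe (d + 1) * periodConst (kappa163 (d + 1)) d + (d + 1) * KHd d))
              * Real.exp (-(dec d * torusSupNorm M (rep M y' - rep M y))) ∧
          (∀ A : (k : ℕ) → (Fin (d + 1) → Fin (k + 1)), (∀ k ν, (A k ν : ℕ) = ⌊((k : ℝ) + 1) * t ν⌋₊) →
              Tendsto (fun k : ℕ => HkOp (k + 1) M (bpt (k + 1) M y' (A k), μ) (y, lam)) atTop
                (𝓝 (Hc t (y', μ) (y, lam)))) ∧
          (∀ (L : ℕ) [NeZero L] (k : ℕ) (a : Fin (d + 1) → Fin (lev L k)),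
              (∀ ν, (a ν : ℕ) = ⌊((lev L k : ℕ) : ℝ) * t ν⌋₊) →
              ‖HkOp (lev L k) M (bpt (lev L k) M y' a, μ) (y, lam) - Hc t (y', μ) (y, lam)‖
                ≤ (CGe (d + 1) * periodConst (kappa163 (d + 1)) d + (d + 1) * KHd d) * ((L : ℝ)⁻¹) ^ k
                    * Real.exp (-(dec d * torusSupNorm M (rep M y' - rep M y))))) ∧
      (∀ (t t' : Fin (d + 1) → ℝ), (∀ ν, 0 ≤ t ν) → (∀ ν, t ν < 1) → (∀ ν, 0 ≤ t' ν) → (∀ ν, t' ν < 1) →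
        ∀ (y' : Tor M) (μ : Fin (d + 1)) (y : Tor M) (lam : Fin (d + 1)),
          ‖Hc t (y', μ) (y, lam) - Hc t' (y', μ) (y, lam)‖
            ≤ KHd d * (∑ ν, |t ν - t' ν|) * Real.exp (-(dec d * torusSupNorm M (rep M y' - rep M y)))) := by
  -- choose the entry limits (value `0` off the admissible offsets)
  have key : ∀ (t : Fin (d + 1) → ℝ) (i j : Tor M × Fin (d + 1)), ∃ s : ℂ, ((∀ ν, 0 ≤ t ν) → (∀ ν, t ν < 1) →
      (∀ (n : ℕ) [NeZero n] (a : Fin (d + 1) → Fin n), (∀ ν, (a ν : ℕ) = ⌊(n : ℝ) * t ν⌋₊) →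
          ‖HkOp n M (bpt n M i.1 a, i.2) (j.1, j.2) - s‖
            ≤ (CGe (d + 1) * periodConst (kappa163 (d + 1)) d + (d + 1) * KHd d) * ((n : ℝ))⁻¹
                * Real.exp (-(dec d * torusSupNorm M (rep M i.1 - rep M j.1)))) ∧
      ‖s‖ ≤ (MG163 (d + 1) * periodConst (kappa163 (d + 1)) d
              + (CGe (d + 1) * periodConst (kappa163 (d + 1)) d + (d + 1) * KHd d))
            * Real.exp (-(dec d * torusSupNorm M (rep M i.1 - rep M j.1))) ∧
      (∀ A : (k : ℕ) → (Fin (d + 1) → Fin (k + 1)), (∀ k ν, (A k ν : ℕ) = ⌊((k : ℝ) + 1) * t ν⌋₊) →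
          Tendsto (fun k : ℕ => HkOp (k + 1) M (bpt (k + 1) M i.1 (A k), i.2) (j.1, j.2)) atTop (𝓝 s))) := by
    intro t i j
    by_cases ht : (∀ ν, 0 ≤ t ν) ∧ (∀ ν, t ν < 1)
    · obtain ⟨s, hs⟩ := exists_entry_limit M t ht.1 ht.2 i.1 i.2 j.1 j.2
      exact ⟨s, fun _ _ => hs⟩
    · exact ⟨0, fun h0 h1 => (ht ⟨h0, h1⟩).elim⟩
  choose Hc hHc using key
  refine ⟨fun t => Matrix.of fun i j => Hc t i j, fun t h0 h1 y' μ y lam => ?_, fun t t' h0 h1 h0' h1' y' μ y lam => ?_⟩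
  · obtain ⟨htail, hsize, hlim⟩ := hHc t (y', μ) (y, lam) h0 h1
    simp only [Matrix.of_apply]
    refine ⟨htail, hsize, hlim, fun L _ k a ha => ?_⟩
    rw [← inv_cast_lev L k]
    exact htail (lev L k) a ha
  · simp only [Matrix.of_apply]
    exact norm_sub_le_of_tails M t t' h0 h1 h0' h1' y' μ y lam (hHc t (y', μ) (y, lam) h0 h1).1
      (hHc t' (y', μ) (y, lam) h0' h1').1

/-! ## §4 (v1.1 APPEND, gen 38) Uniqueness: the named kernel is canonical on the admissible cube -/

/-- **UNIQUENESS OF THE ENTRY LIMIT** (leaf-04 g52's XREAD engine (c1), typed): two values obeying the full-sequence tail (any constant `K`) at the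
digits of the SAME admissible offset `t` coincide — `norm_sub_le_of_tails` at `t′ = t` (`Σ_ν |t_ν − t_ν| = 0`).  Hence any two kernels with property
(A)(i) of `exists_HkOp_continuum_kernel` agree entrywise on `[0,1)^{d+1}`: the `choose`-built census kernel `Hc t` is CANONICAL there (junk only off the
cube, where nothing is asserted). [folklore] -/
theorem entry_limit_unique (t : Fin (d + 1) → ℝ) (ht0 : ∀ ν, 0 ≤ t ν) (ht1 : ∀ ν, t ν < 1) (y' : Tor M) (μ : Fin (d + 1)) (y : Tor M)
    (lam : Fin (d + 1)) {K : ℝ} {s s' : ℂ}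
    (hs : ∀ (n : ℕ) [NeZero n] (a : Fin (d + 1) → Fin n), (∀ ν, (a ν : ℕ) = ⌊(n : ℝ) * t ν⌋₊) →
      ‖HkOp n M (bpt n M y' a, μ) (y, lam) - s‖ ≤ K * ((n : ℝ))⁻¹ * Real.exp (-(dec d * torusSupNorm M (rep M y' - rep M y))))
    (hs' : ∀ (n : ℕ) [NeZero n] (a : Fin (d + 1) → Fin n), (∀ ν, (a ν : ℕ) = ⌊(n : ℝ) * t ν⌋₊) →
      ‖HkOp n M (bpt n M y' a, μ) (y, lam) - s'‖ ≤ K * ((n : ℝ))⁻¹ * Real.exp (-(dec d * torusSupNorm M (rep M y' - rep M y)))) :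
    s = s' := by
  have h := norm_sub_le_of_tails M t t ht0 ht1 ht0 ht1 y' μ y lam hs hs'
  simp only [sub_self, abs_zero, Finset.sum_const_zero, mul_zero, zero_mul] at h
  exact sub_eq_zero.mp (norm_le_zero_iff.mp h)

end Continuum

end Summit.QuantumFields.BalabanUV.Beta.GAN24.HkContinuumKernelLimit

end
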